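import Literature.NumberTheory.Automorphic.CompactGroupKFiniteVectorsPeterWeyl
import Literature.NumberTheory.Automorphic.HilbertRepOrthogonalDecomposition
import Literature.Analysis.OperatorTheory.NuclearAlongOrthogonalFiniteBlocks
import HarnessLib

/-!
# Block-nuclear operators on a unitary representation of a compact group are trace class: the `K`-irreducible orthogonal
# decomposition as the blocks of Knapp's proof of Thm. 10.2 (Bröcker–tom Dieck III (5.7); Reed–Simon I, Thm. VI.24)

Topic `NumberTheory/Automorphic`; namespace `Literature.NumberTheory.Automorphic`; theorems only (no definition, no named fact, no instance, no
`sorry`).  Cell `hodgecm-mathlib`, line T1a, road HC to the letter ★ `UnitaryGroup.ArchIntegratedOperatorTraceClass` ([Knapp1986, Thm. 10.2]), node H2 in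
representation-theoretic dress: continuation of ★ `Literature.Analysis.OperatorTheory.NuclearAlongOrthogonalFiniteBlocks` (pure Hilbert space: pairwise
orthogonal finite-dimensional blocks of dense sum + `Σ_i dim V_i · ‖T|_{V_i}‖ < ∞` ⇒ the three trace-class clauses), ★ `CompactGroupKFiniteVectorsPeterWeyl`
(`isDiscretelyDecomposable_of_compactSpace`, `finiteDimensional_of_isTopIrreducible_toContRep`) and ★ `HilbertRepOrthogonalDecomposition`
(`IsUnitary.exists_orthogonalDecomposition_of_isDiscretelyDecomposable`).

THE STATEMENTS.  `K` a compact Hausdorff topological group, `σ` a unitary strongly continuous representation of `K` on a complex Hilbert space `E`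
(in the application: the restriction `ϖ|_K` of a unitary representation of `U(2,1)` to `K = U(2) × U(1)`, pulled back to `G′_∞`).
* `exists_irreducible_orthogonal_blocks` — `E = ⊕̂_{W ∈ S} W` for a set `S` of pairwise orthogonal, topologically irreducible, FINITE-DIMENSIONAL closed
  subrepresentations (Peter–Weyl), in the block format of ★ `NuclearAlongOrthogonalFiniteBlocks` (`OrthogonalFamily` + `(⨆ W, W)ᗮ = ⊥`);
* `traceClass_clauses_of_irreducible_blocks` — for ANY such `S` and any bounded `T : E → E`: if `‖T v‖ ≤ c_W ‖v‖` on each `W ∈ S` with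
  `Σ_{W ∈ S} dim W · c_W < ∞`, then `T` is Hilbert–Schmidt along every Hilbert basis, with summable and basis-free diagonal (the three clauses of the letter);
* `exists_hilbertBasis_summable_norm_apply_of_irreducible_blocks` — the adapted Hilbert basis with `Σ_k ‖T e_k‖ ≤ Σ_W dim W · c_W` (the input of ★
  `UnitaryGroup.archIntegratedOperatorTraceClass_of_summable_norm_apply`, node H0′).
In Knapp's proof `c_W = ‖(1 + Ω_K)^N f‖_{L¹} (1 + c(τ_W))^{-N}` with `c(τ_W)` the Casimir eigenvalue of the `K`-type of `W`, and `Σ_W dim W · c_W =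
‖…‖ Σ_τ m(τ) d(τ) (1 + c(τ))^{-N}` (★ `IsUnitary.multiplicity_eq_card`) — nodes H3–H5 of the line card, NOT proved here.

## References
* T. Bröcker, T. tom Dieck, *Representations of Compact Lie Groups* (1985), III (5.6)–(5.7) [BrockerTomDieck1985].
* J. Dixmier, *C\*-algebras* (1977), 5.4.1 [Dixmier1977].
* M. Reed, B. Simon, *Methods of Modern Mathematical Physics I* (1972), Thm. II.6, VI.24 [ReedSimon1972].
* A. W. Knapp, *Representation Theory of Semisimple Groups: An Overview Based on Examples* (1986), Thm. 10.2 (proof) [Knapp1986].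
-/

set_option autoImplicit false

noncomputable section

open Literature.Analysis.OperatorTheory
open scoped InnerProductSpace ENNReal NNReal

namespace Literature.NumberTheory.Automorphic

variable {K : Type*} [TopologicalSpace K] [Group K] [IsTopologicalGroup K] [CompactSpace K] [T2Space K]
  {E : Type*} [NormedAddCommGroup E] [InnerProductSpace ℂ E] [CompleteSpace E]
  {σ : ContRepresentation ℂ K E}

/-- **PETER–WEYL IN BLOCK FORM**: a unitary strongly continuous representation of a compact Hausdorff group on a Hilbert space is the Hilbert sum of a set
`S` of pairwise orthogonal, topologically irreducible, finite-dimensional closed subrepresentations — `OrthogonalFamily` over `S` and `(⨆_{W ∈ S} W)ᗮ = 0`.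
[cite: BrockerTomDieck1985, III (5.7)] [cite: Dixmier1977, 5.4.1] -/
theorem exists_irreducible_orthogonal_blocks (hc : σ.IsStronglyContinuous) (hu : σ.IsUnitary) :
    ∃ S : Set (ContRepresentation.ClosedSubrep σ),
      (∀ W ∈ S, W.toContRep.IsTopIrreducible) ∧
      (∀ W ∈ S, FiniteDimensional ℂ W.toSubmodule) ∧
      OrthogonalFamily ℂ (fun W : S => ((W : ContRepresentation.ClosedSubrep σ).toSubmodule : Submodule ℂ E))
        (fun W : S => (W : ContRepresentation.ClosedSubrep σ).toSubmodule.subtypeₗᵢ) ∧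
      (⨆ W : S, (W : ContRepresentation.ClosedSubrep σ).toSubmodule)ᗮ = ⊥ := by
  obtain ⟨S, hirr, horth, htop⟩ :=
    hu.exists_orthogonalDecomposition_of_isDiscretelyDecomposable (isDiscretelyDecomposable_of_compactSpace hc hu)
  refine ⟨S, hirr, fun W hW => finiteDimensional_of_isTopIrreducible_toContRep hc (hirr W hW), ?_,
    ContRepresentation.ClosedSubrep.orthogonal_iSup_eq_bot_of_iSupClosure_eq_top htop⟩
  exact OrthogonalFamily.of_pairwise (ContRepresentation.ClosedSubrep.pairwise_subtype_isOrtho horth)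

omit [TopologicalSpace K] [IsTopologicalGroup K] [CompactSpace K] [T2Space K] in
/-- **The adapted Hilbert basis of an irreducible decomposition**: for `S` as above (pairwise orthogonal, finite-dimensional members, dense sum) and a
bounded `T` with `‖T v‖ ≤ c_W ‖v‖` on each `W ∈ S` and `Σ_W dim W · c_W < ∞`, there is a Hilbert basis `e` of `E`, each vector inside one block, with
`Σ_k ‖T e_k‖ ≤ Σ_W dim W · c_W < ∞`. [cite: ReedSimon1972, Thm. II.6, VI.24] [cite: Knapp1986, Thm. 10.2 (proof)] -/
theorem exists_hilbertBasis_summable_norm_apply_of_irreducible_blocks {S : Set (ContRepresentation.ClosedSubrep σ)}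
    (hfd : ∀ W ∈ S, FiniteDimensional ℂ W.toSubmodule)
    (horth : OrthogonalFamily ℂ (fun W : S => ((W : ContRepresentation.ClosedSubrep σ).toSubmodule : Submodule ℂ E))
      (fun W : S => (W : ContRepresentation.ClosedSubrep σ).toSubmodule.subtypeₗᵢ))
    (hdense : (⨆ W : S, (W : ContRepresentation.ClosedSubrep σ).toSubmodule)ᗮ = ⊥)
    (T : E →L[ℂ] E) (c : S → ℝ)
    (hcT : ∀ W : S, ∀ v ∈ (W : ContRepresentation.ClosedSubrep σ).toSubmodule, ‖T v‖ ≤ c W * ‖v‖)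
    (hsum : Summable fun W : S => (Module.finrank ℂ (W : ContRepresentation.ClosedSubrep σ).toSubmodule : ℝ) * c W) :
    ∃ B : HilbertBasis (Σ W : S, Fin (Module.finrank ℂ (W : ContRepresentation.ClosedSubrep σ).toSubmodule)) ℂ E,
      (∀ p, B p ∈ (p.1 : ContRepresentation.ClosedSubrep σ).toSubmodule) ∧ (Summable fun p => ‖T (B p)‖) ∧
      ∑' p, ‖T (B p)‖ ≤ ∑' W : S, (Module.finrank ℂ (W : ContRepresentation.ClosedSubrep σ).toSubmodule : ℝ) * c W := by
  haveI : ∀ W : S, FiniteDimensional ℂ (W : ContRepresentation.ClosedSubrep σ).toSubmodule := fun W => hfd W W.2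
  exact exists_hilbertBasis_summable_norm_apply_of_blocks horth hdense T c hcT hsum

omit [TopologicalSpace K] [IsTopologicalGroup K] [CompactSpace K] [T2Space K] in
/-- **BLOCK-NUCLEAR ON A COMPACT-GROUP REPRESENTATION ⇒ THE THREE TRACE-CLASS CLAUSES**: for `S` as above and a bounded `T` with `‖T v‖ ≤ c_W ‖v‖` on each
block `W ∈ S` and `Σ_W dim W · c_W < ∞`: `Σ_j ‖T b_j‖² < ∞` for every Hilbert basis `b`, the diagonal `j ↦ ⟨b_j, T b_j⟩` is summable, and its sum is
basis free. [cite: ReedSimon1972, Thm. VI.24] [cite: Knapp1986, Thm. 10.2 (proof)] -/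
theorem traceClass_clauses_of_irreducible_blocks {S : Set (ContRepresentation.ClosedSubrep σ)}
    (hfd : ∀ W ∈ S, FiniteDimensional ℂ W.toSubmodule)
    (horth : OrthogonalFamily ℂ (fun W : S => ((W : ContRepresentation.ClosedSubrep σ).toSubmodule : Submodule ℂ E))
      (fun W : S => (W : ContRepresentation.ClosedSubrep σ).toSubmodule.subtypeₗᵢ))
    (hdense : (⨆ W : S, (W : ContRepresentation.ClosedSubrep σ).toSubmodule)ᗮ = ⊥)
    (T : E →L[ℂ] E) (c : S → ℝ)
    (hcT : ∀ W : S, ∀ v ∈ (W : ContRepresentation.ClosedSubrep σ).toSubmodule, ‖T v‖ ≤ c W * ‖v‖)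
    (hsum : Summable fun W : S => (Module.finrank ℂ (W : ContRepresentation.ClosedSubrep σ).toSubmodule : ℝ) * c W) :
    ∀ (κ : Type*) (b : HilbertBasis κ ℂ E),
      (∑' j, (‖T (b j)‖₊ : ℝ≥0∞) ^ 2 < ∞) ∧
      Summable (fun j => ⟪b j, T (b j)⟫_ℂ) ∧
      ∀ (κ' : Type*) (b' : HilbertBasis κ' ℂ E), ∑' j, ⟪b j, T (b j)⟫_ℂ = ∑' j, ⟪b' j, T (b' j)⟫_ℂ := by
  haveI : ∀ W : S, FiniteDimensional ℂ (W : ContRepresentation.ClosedSubrep σ).toSubmodule := fun W => hfd W W.2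
  exact traceClass_clauses_of_blocks horth hdense T c hcT hsum

/-- **The form a payer of Knapp's estimate uses**: on a unitary strongly continuous representation of a compact Hausdorff group, a bounded `T` is trace class
(three clauses) as soon as, for SOME irreducible orthogonal decomposition `S` (one exists: `exists_irreducible_orthogonal_blocks`), block bounds `c_W` with
`Σ_W dim W · c_W < ∞` are available. [cite: Knapp1986, Thm. 10.2 (proof)] [cite: ReedSimon1972, Thm. VI.24] -/
theorem traceClass_clauses_of_forall_decomposition (hc : σ.IsStronglyContinuous) (hu : σ.IsUnitary) (T : E →L[ℂ] E)
    (h : ∀ S : Set (ContRepresentation.ClosedSubrep σ),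
      (∀ W ∈ S, W.toContRep.IsTopIrreducible) → (∀ W ∈ S, FiniteDimensional ℂ W.toSubmodule) →
      OrthogonalFamily ℂ (fun W : S => ((W : ContRepresentation.ClosedSubrep σ).toSubmodule : Submodule ℂ E))
        (fun W : S => (W : ContRepresentation.ClosedSubrep σ).toSubmodule.subtypeₗᵢ) →
      (⨆ W : S, (W : ContRepresentation.ClosedSubrep σ).toSubmodule)ᗮ = ⊥ →
      ∃ c : S → ℝ, (∀ W : S, ∀ v ∈ (W : ContRepresentation.ClosedSubrep σ).toSubmodule, ‖T v‖ ≤ c W * ‖v‖) ∧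
        Summable fun W : S => (Module.finrank ℂ (W : ContRepresentation.ClosedSubrep σ).toSubmodule : ℝ) * c W) :
    ∀ (κ : Type*) (b : HilbertBasis κ ℂ E),
      (∑' j, (‖T (b j)‖₊ : ℝ≥0∞) ^ 2 < ∞) ∧
      Summable (fun j => ⟪b j, T (b j)⟫_ℂ) ∧
      ∀ (κ' : Type*) (b' : HilbertBasis κ' ℂ E), ∑' j, ⟪b j, T (b j)⟫_ℂ = ∑' j, ⟪b' j, T (b' j)⟫_ℂ := by
  obtain ⟨S, hirr, hfd, horth, hdense⟩ := exists_irreducible_orthogonal_blocks hc hu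
  obtain ⟨c, hcT, hsum⟩ := h S hirr hfd horth hdense
  exact traceClass_clauses_of_irreducible_blocks hfd horth hdense T c hcT hsum

end Literature.NumberTheory.Automorphic

end
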